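import Literature.MathematicalPhysics.QuantumFieldTheory.AnisotropicTwistedPartitionFunctionStrongCouplingRate
import HarnessLib

/-!
# The TEMPORAL-plane stack twist on 't Hooft's anisotropic `Fin`-box: translates of the `(0,3)`-stack, locality below the area
# `n₀ · n₃`, and the strong-coupling bound `|ln Z_z(L_s,L_t) - ln Z_1(L_s,L_t)| ≤ 12 L_s³L_t (4·97²e·N|β|)^{L_s L_t}` for the plane `(0,3)`

Topic `Literature/MathematicalPhysics/QuantumFieldTheory`; the `(0,3)`-twin of `FinTorusPlaquetteSystem.lean` (translates `finTorusStack a b` of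
the `(0,1)`-stack), `FinTorusStackTwistLocality.lean` (their equal polymer activities and the locality threshold `n₀ · n₁`; its docstring:
"plane `(0,1)` only (TODO(general form): other planes by symmetry)") and `AnisotropicTwistedPartitionFunctionStrongCoupling(Rate).lean` (the
bridge to `twistedPartitionFunctionAniso … (0,1)` and the Kotecký–Preiss bound with rate).  For a TEMPORAL plane the twisted plaquettes have
area `L_s · L_t` on the box `L_s³ × L_t`, so the bound is exponentially small in `L_s L_t`:

* `finTorusStack03 a b`, `finTorusStackTwist03 z a b` — the `n₀ n₃` translates `{x₀ = a, x₃ = b}` of the stack of `(0,3)`-plaquettes and the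
  insertion `z·𝟙`; `mem_finTorusStack03`, `disjoint_finTorusStack03`, `finTorusStackTwist03_apply`;
* `polymerActivity_finTorusStackTwist03_rotate_fst/_snd`, `…_eq`, ★ `polymerActivity_finTorusStackTwist03_eq_of_card_lt` — central `z`:
  all translates carry the same polymer activities (coboundaries of `3`-links resp. `0`-links), so a plaquette set with fewer than
  `n₀ · n₃` plaquettes does not see the twist;
* `twistedPartitionFunctionAniso_03_eq_mul_Z` — bridge: `Z_aniso(z; (0,3); L_s, L_t) = e^{-βN·#P} · Z(Wilson family twisted by z·𝟙_{stack03(0,0)})`;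
* ★★ `abs_log_twistedPartitionFunctionAniso_03_sub_le_pow` — for `0 < N|β| ≤ 1/(4·97²e²)`, central `z`, every `L_s, L_t ≥ 1`:
  `|ln Z_z(L_s,L_t) - ln Z_1(L_s,L_t)| ≤ 12 · L_s³L_t · (4·97²e·N|β|)^{L_s L_t}` for the temporal plane `(0,3)`.

HONEST FRAMING: strong coupling; plane `(0,3)` only (the other two temporal planes by the symmetry of the three spatial axes); crude
constants.  This is the CEILING half, for a temporal plane, of the comparison `t_z(L_s,L_t) ≤ t_z(2L_s,L_t)`; nothing about weak coupling,
confinement or a mass gap.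

References: G. 't Hooft, Nucl. Phys. B153 (1979) 141 [tHooft1979Flux] §2; E. T. Tomboulis, arXiv:0707.2179 [Tomboulis2007Confinement] §4, §6.2;
K. R. Ito, E. Seiler, arXiv:0803.3019 [ItoSeiler2008Further] Thm 2.2 (1).
-/

noncomputable section

open MeasureTheory Finset
open scoped BigOperators

namespace Literature.MathematicalPhysics.QuantumFieldTheory

variable {n₀ n₁ n₂ n₃ : ℕ}

/-! ### The translates of the `(0,3)`-stack -/

/-- **The `(0,3)`-stack at position `(a, b)`**: all plaquettes `(x; 0, 3)` with `x₀ = a`, `x₃ = b` (every `x₁, x₂`): 't Hooft's twist of the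
temporal plane `(0,3)` sits on the stack at `(0, 0)`. [cite: tHooft1979Flux, §2 (2.5)–(2.6)] [cite: Tomboulis2007Confinement, §4 (text after eq. (4.1))] -/
def finTorusStack03 (n₁ n₂ : ℕ) (a : Fin n₀) (b : Fin n₃) : Finset (FinTorusPlaquette n₀ n₁ n₂ n₃) :=
  Finset.univ.filter fun p => p.2 = ⟨((0 : Fin 4), (3 : Fin 4)), by decide⟩ ∧ p.1.1 = a ∧ p.1.2.2.2 = b

/-- The twist insertion on a translate of the `(0,3)`-stack. [cite: tHooft1979Flux, §2 (2.5)–(2.6)] -/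
def finTorusStackTwist03 {G : Type*} [One G] (n₁ n₂ : ℕ) (z : G) (a : Fin n₀) (b : Fin n₃) :
    FinTorusPlaquette n₀ n₁ n₂ n₃ → G :=
  fun p => if p ∈ finTorusStack03 n₁ n₂ a b then z else 1

/-- Membership in a translate of the `(0,3)`-stack. [cite: Tomboulis2007Confinement, §4 (text after eq. (4.1))] -/
theorem mem_finTorusStack03 {a : Fin n₀} {b : Fin n₃} {p : FinTorusPlaquette n₀ n₁ n₂ n₃} :
    p ∈ finTorusStack03 n₁ n₂ a b ↔ p.2 = ⟨((0 : Fin 4), (3 : Fin 4)), by decide⟩ ∧ p.1.1 = a ∧ p.1.2.2.2 = b := by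
  simp [finTorusStack03]

/-- Distinct positions give disjoint translates. [cite: Tomboulis2007Confinement, §4 (text after eq. (4.1))] -/
theorem disjoint_finTorusStack03 {ab ab' : Fin n₀ × Fin n₃} (h : ab ≠ ab') :
    Disjoint (finTorusStack03 n₁ n₂ ab.1 ab.2 : Finset (FinTorusPlaquette n₀ n₁ n₂ n₃)) (finTorusStack03 n₁ n₂ ab'.1 ab'.2) := by
  rw [Finset.disjoint_left]
  intro p hp hp'
  rw [mem_finTorusStack03] at hp hp'
  exact h (Prod.ext (hp.2.1.symm.trans hp'.2.1) (hp.2.2.symm.trans hp'.2.2))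

section Apply

variable {G : Type*}

/-- The insertion is trivial off its stack. [cite: Tomboulis2007Confinement, §4 eq. (4.4)] -/
theorem finTorusStackTwist03_of_not_mem [One G] {z : G} {a : Fin n₀} {b : Fin n₃} {p : FinTorusPlaquette n₀ n₁ n₂ n₃}
    (hp : p ∉ finTorusStack03 n₁ n₂ a b) : finTorusStackTwist03 n₁ n₂ z a b p = 1 := by
  simp [finTorusStackTwist03, hp]

/-- The insertion read through coordinates. [cite: tHooft1979Flux, §2 (2.5)–(2.6)] -/
theorem finTorusStackTwist03_apply [One G] (z : G) (a : Fin n₀) (b : Fin n₃) (p : FinTorusPlaquette n₀ n₁ n₂ n₃) :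
    finTorusStackTwist03 n₁ n₂ z a b p =
      if p.2 = ⟨((0 : Fin 4), (3 : Fin 4)), by decide⟩ ∧ p.1.1 = a ∧ p.1.2.2.2 = b then z else 1 := by
  simp only [finTorusStackTwist03, mem_finTorusStack03]

/-- No twist: the insertion of `z = 1` is trivial. [cite: tHooft1979Flux, §2 (2.6)] -/
theorem finTorusStackTwist03_one [One G] (a : Fin n₀) (b : Fin n₃) :
    finTorusStackTwist03 n₁ n₂ (1 : G) a b = fun _ => 1 := by
  funext p; simp [finTorusStackTwist03_apply]

end Apply

/-! ### The fourth coordinate under the shifts (plumbing) -/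

section Shift

/-- Shifts in directions `≠ 3` fix the fourth coordinate. [cite: SeilerLNP1982, Ch. 2] -/
theorem finTorusSite_shift_snd_snd_snd {μ : Fin 4} (hμ : μ ≠ 3) (x : FinTorusSite n₀ n₁ n₂ n₃) : (x.shift μ).2.2.2 = x.2.2.2 := by
  fin_cases μ <;> simp_all [FinTorusSite.shift]

/-- The shift in direction `3` rotates the fourth coordinate. [cite: SeilerLNP1982, Ch. 2] -/
@[simp] theorem finTorusSite_shift_three_snd_snd_snd (x : FinTorusSite n₀ n₁ n₂ n₃) : (x.shift 3).2.2.2 = finRotate n₃ x.2.2.2 := by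
  simp [FinTorusSite.shift]

/-- The shift in direction `0` fixes the fourth coordinate. [cite: SeilerLNP1982, Ch. 2] -/
@[simp] theorem finTorusSite_shift_zero_snd_snd_snd (x : FinTorusSite n₀ n₁ n₂ n₃) : (x.shift 0).2.2.2 = x.2.2.2 := by
  simp [FinTorusSite.shift]

/-- The shift in direction `1` fixes the fourth coordinate. [cite: SeilerLNP1982, Ch. 2] -/
@[simp] theorem finTorusSite_shift_one_snd_snd_snd (x : FinTorusSite n₀ n₁ n₂ n₃) : (x.shift 1).2.2.2 = x.2.2.2 := by
  simp [FinTorusSite.shift]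

/-- The shift in direction `2` fixes the fourth coordinate. [cite: SeilerLNP1982, Ch. 2] -/
@[simp] theorem finTorusSite_shift_two_snd_snd_snd (x : FinTorusSite n₀ n₁ n₂ n₃) : (x.shift 2).2.2.2 = x.2.2.2 := by
  simp [FinTorusSite.shift]

end Shift

/-! ### Moving the stack: the two coboundaries -/

section Moves

variable {G : Type*} [Group G] [TopologicalSpace G] [IsTopologicalGroup G] [CompactSpace G] [MeasurableSpace G]
  [BorelSpace G]

/-- the six planes, for case analysis (plumbing). [folklore] -/
private theorem plane_cases' (q : {q : Fin 4 × Fin 4 // q.1 < q.2}) :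
    q = ⟨(0, 1), by decide⟩ ∨ q = ⟨(0, 2), by decide⟩ ∨ q = ⟨(0, 3), by decide⟩ ∨ q = ⟨(1, 2), by decide⟩ ∨
      q = ⟨(1, 3), by decide⟩ ∨ q = ⟨(2, 3), by decide⟩ := by
  revert q
  decide

omit [TopologicalSpace G] [IsTopologicalGroup G] [CompactSpace G] [MeasurableSpace G] [BorelSpace G] in
/-- The coboundary of the `3`-link function `[y₀ = a + 1, y₃ = b] z` corrects the stack insertion at `(a + 1, b)` into the one at `(a, b)`.
[cite: Tomboulis2007Confinement, §4 (text after eq. (4.1))] -/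
private theorem stackTwist03_mul_coboundary_fst (z : G) (a : Fin n₀) (b : Fin n₃) (x : FinTorusSite n₀ n₁ n₂ n₃)
    (q : {q : Fin 4 × Fin 4 // q.1 < q.2}) :
    finTorusStackTwist03 n₁ n₂ z (finRotate n₀ a) b (x, q) *
        ((fun l : FinTorusLink n₀ n₁ n₂ n₃ => if l.2 = 3 ∧ l.1.1 = finRotate n₀ a ∧ l.1.2.2.2 = b then z else 1) (x, q.1.1) *
          (fun l : FinTorusLink n₀ n₁ n₂ n₃ => if l.2 = 3 ∧ l.1.1 = finRotate n₀ a ∧ l.1.2.2.2 = b then z else 1)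
            (x.shift q.1.1, q.1.2) *
          ((fun l : FinTorusLink n₀ n₁ n₂ n₃ => if l.2 = 3 ∧ l.1.1 = finRotate n₀ a ∧ l.1.2.2.2 = b then z else 1)
            (x.shift q.1.2, q.1.1))⁻¹ *
          ((fun l : FinTorusLink n₀ n₁ n₂ n₃ => if l.2 = 3 ∧ l.1.1 = finRotate n₀ a ∧ l.1.2.2.2 = b then z else 1)
            (x, q.1.2))⁻¹) =
      finTorusStackTwist03 n₁ n₂ z a b (x, q) := by
  rcases plane_cases' q with rfl | rfl | rfl | rfl | rfl | rfl <;>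
    simp only [finTorusStackTwist03_apply, finTorusSite_shift_zero_fst, finTorusSite_shift_zero_snd_snd_snd,
      finTorusSite_shift_one_fst, finTorusSite_shift_one_snd_snd_snd, finTorusSite_shift_two_fst,
      finTorusSite_shift_two_snd_snd_snd, finTorusSite_shift_three_fst, finTorusSite_shift_three_snd_snd_snd,
      EmbeddingLike.apply_eq_iff_eq, true_and, false_and, if_false, Fin.isValue, Fin.reduceEq, Subtype.mk.injEq,
      Prod.mk.injEq, and_self, one_mul, mul_one, inv_one, and_true]
  all_goals (split_ifs <;> simp)

omit [TopologicalSpace G] [IsTopologicalGroup G] [CompactSpace G] [MeasurableSpace G] [BorelSpace G] in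
/-- The coboundary of the `0`-link function `[y₀ = a, y₃ = b + 1] z` corrects the stack insertion at `(a, b)` into the one at `(a, b + 1)`.
[cite: Tomboulis2007Confinement, §4 (text after eq. (4.1))] -/
private theorem stackTwist03_mul_coboundary_snd (z : G) (a : Fin n₀) (b : Fin n₃) (x : FinTorusSite n₀ n₁ n₂ n₃)
    (q : {q : Fin 4 × Fin 4 // q.1 < q.2}) :
    finTorusStackTwist03 n₁ n₂ z a b (x, q) *
        ((fun l : FinTorusLink n₀ n₁ n₂ n₃ => if l.2 = 0 ∧ l.1.1 = a ∧ l.1.2.2.2 = finRotate n₃ b then z else 1) (x, q.1.1) *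
          (fun l : FinTorusLink n₀ n₁ n₂ n₃ => if l.2 = 0 ∧ l.1.1 = a ∧ l.1.2.2.2 = finRotate n₃ b then z else 1)
            (x.shift q.1.1, q.1.2) *
          ((fun l : FinTorusLink n₀ n₁ n₂ n₃ => if l.2 = 0 ∧ l.1.1 = a ∧ l.1.2.2.2 = finRotate n₃ b then z else 1)
            (x.shift q.1.2, q.1.1))⁻¹ *
          ((fun l : FinTorusLink n₀ n₁ n₂ n₃ => if l.2 = 0 ∧ l.1.1 = a ∧ l.1.2.2.2 = finRotate n₃ b then z else 1)
            (x, q.1.2))⁻¹) =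
      finTorusStackTwist03 n₁ n₂ z a (finRotate n₃ b) (x, q) := by
  rcases plane_cases' q with rfl | rfl | rfl | rfl | rfl | rfl <;>
    simp only [finTorusStackTwist03_apply, finTorusSite_shift_zero_fst, finTorusSite_shift_zero_snd_snd_snd,
      finTorusSite_shift_one_fst, finTorusSite_shift_one_snd_snd_snd, finTorusSite_shift_two_fst,
      finTorusSite_shift_two_snd_snd_snd, finTorusSite_shift_three_fst, finTorusSite_shift_three_snd_snd_snd,
      EmbeddingLike.apply_eq_iff_eq, true_and, false_and, if_false, Fin.isValue, Fin.reduceEq, Subtype.mk.injEq,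
      Prod.mk.injEq, and_self, one_mul, mul_one, inv_one, and_true]
  all_goals (split_ifs <;> simp)

/-- **Moving the `(0,3)`-stack in direction `0`** (central `z`): the twisted families at `(a + 1, b)` and `(a, b)` have the same polymer
activities. [cite: Tomboulis2007Confinement, §4 (text after eq. (4.1))] -/
theorem polymerActivity_finTorusStackTwist03_rotate_fst {z : G} (hz : z ∈ Subgroup.center G) (a : Fin n₀) (b : Fin n₃)
    (w : FinTorusPlaquette n₀ n₁ n₂ n₃ → G → ℝ) (X : Finset (FinTorusPlaquette n₀ n₁ n₂ n₃)) :
    (finTorusSystem n₀ n₁ n₂ n₃ G).polymerActivity (twistFamily (finTorusStackTwist03 n₁ n₂ z (finRotate n₀ a) b) w) X =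
      (finTorusSystem n₀ n₁ n₂ n₃ G).polymerActivity (twistFamily (finTorusStackTwist03 n₁ n₂ z a b) w) X := by
  let c : FinTorusLink n₀ n₁ n₂ n₃ → G := fun l => if l.2 = 3 ∧ l.1.1 = finRotate n₀ a ∧ l.1.2.2.2 = b then z else 1
  have hc : ∀ l, c l ∈ Subgroup.center G := fun l => by
    dsimp only [c]
    split_ifs
    · exact hz
    · exact Subgroup.one_mem _
  rw [(finTorusSystem n₀ n₁ n₂ n₃ G).polymerActivity_twistFamily_eq_of_mul_links c
    (σ := fun p => c (p.1, p.2.1.1) * c (p.1.shift p.2.1.1, p.2.1.2) * (c (p.1.shift p.2.1.2, p.2.1.1))⁻¹ * (c (p.1, p.2.1.2))⁻¹)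
    (fun U p => finTorusPlaquette_mul_links c hc U p.1 p.2.1.1 p.2.1.2)]
  have key : (fun p : FinTorusPlaquette n₀ n₁ n₂ n₃ => finTorusStackTwist03 n₁ n₂ z (finRotate n₀ a) b p *
      (c (p.1, p.2.1.1) * c (p.1.shift p.2.1.1, p.2.1.2) * (c (p.1.shift p.2.1.2, p.2.1.1))⁻¹ * (c (p.1, p.2.1.2))⁻¹)) =
      finTorusStackTwist03 n₁ n₂ z a b :=
    funext fun p => stackTwist03_mul_coboundary_fst z a b p.1 p.2
  rw [key]

/-- **Moving the `(0,3)`-stack in direction `3`** (central `z`). [cite: Tomboulis2007Confinement, §4 (text after eq. (4.1))] -/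
theorem polymerActivity_finTorusStackTwist03_rotate_snd {z : G} (hz : z ∈ Subgroup.center G) (a : Fin n₀) (b : Fin n₃)
    (w : FinTorusPlaquette n₀ n₁ n₂ n₃ → G → ℝ) (X : Finset (FinTorusPlaquette n₀ n₁ n₂ n₃)) :
    (finTorusSystem n₀ n₁ n₂ n₃ G).polymerActivity (twistFamily (finTorusStackTwist03 n₁ n₂ z a b) w) X =
      (finTorusSystem n₀ n₁ n₂ n₃ G).polymerActivity (twistFamily (finTorusStackTwist03 n₁ n₂ z a (finRotate n₃ b)) w) X := by
  let c : FinTorusLink n₀ n₁ n₂ n₃ → G := fun l => if l.2 = 0 ∧ l.1.1 = a ∧ l.1.2.2.2 = finRotate n₃ b then z else 1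
  have hc : ∀ l, c l ∈ Subgroup.center G := fun l => by
    dsimp only [c]
    split_ifs
    · exact hz
    · exact Subgroup.one_mem _
  rw [(finTorusSystem n₀ n₁ n₂ n₃ G).polymerActivity_twistFamily_eq_of_mul_links c
    (σ := fun p => c (p.1, p.2.1.1) * c (p.1.shift p.2.1.1, p.2.1.2) * (c (p.1.shift p.2.1.2, p.2.1.1))⁻¹ * (c (p.1, p.2.1.2))⁻¹)
    (fun U p => finTorusPlaquette_mul_links c hc U p.1 p.2.1.1 p.2.1.2)]
  have key : (fun p : FinTorusPlaquette n₀ n₁ n₂ n₃ => finTorusStackTwist03 n₁ n₂ z a b p *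
      (c (p.1, p.2.1.1) * c (p.1.shift p.2.1.1, p.2.1.2) * (c (p.1.shift p.2.1.2, p.2.1.1))⁻¹ * (c (p.1, p.2.1.2))⁻¹)) =
      finTorusStackTwist03 n₁ n₂ z a (finRotate n₃ b) :=
    funext fun p => stackTwist03_mul_coboundary_snd z a b p.1 p.2
  rw [key]

/-- Every element of `Fin (m+1)` is reached from `0` by iterating `finRotate`. [folklore] -/
private theorem exists_iterate_finRotate_zero_eq' {m : ℕ} (a : Fin (m + 1)) : ∃ k : ℕ, (finRotate (m + 1))^[k] 0 = a := by
  have hval : ∀ k : ℕ, k < m + 1 → (((finRotate (m + 1))^[k] 0 : Fin (m + 1)) : ℕ) = k := by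
    intro k hk
    induction k with
    | zero => simp
    | succ k ih =>
      have hk' := ih (by omega)
      have hne : (finRotate (m + 1))^[k] 0 ≠ Fin.last m := by
        intro h
        have h' := congrArg Fin.val h
        rw [hk', Fin.val_last] at h'
        omega
      rw [Function.iterate_succ_apply', coe_finRotate_of_ne_last hne, hk']
  exact ⟨a.val, Fin.ext (hval a.val a.isLt)⟩

/-- **All translates of the `(0,3)`-stack carry the same polymer activities** (central `z`). [cite: Tomboulis2007Confinement, §4 (text after eq. (4.1))] -/
theorem polymerActivity_finTorusStackTwist03_eq {z : G} (hz : z ∈ Subgroup.center G) (a a' : Fin n₀) (b b' : Fin n₃)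
    (w : FinTorusPlaquette n₀ n₁ n₂ n₃ → G → ℝ) (X : Finset (FinTorusPlaquette n₀ n₁ n₂ n₃)) :
    (finTorusSystem n₀ n₁ n₂ n₃ G).polymerActivity (twistFamily (finTorusStackTwist03 n₁ n₂ z a b) w) X =
      (finTorusSystem n₀ n₁ n₂ n₃ G).polymerActivity (twistFamily (finTorusStackTwist03 n₁ n₂ z a' b') w) X := by
  obtain ⟨m₀, rfl⟩ := Nat.exists_eq_succ_of_ne_zero (Nat.pos_iff_ne_zero.1 (Fin.pos a))
  obtain ⟨m₃, rfl⟩ := Nat.exists_eq_succ_of_ne_zero (Nat.pos_iff_ne_zero.1 (Fin.pos b))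
  have h0 : ∀ (k : ℕ) (u : Fin (m₀ + 1)) (v : Fin (m₃ + 1)),
      (finTorusSystem (m₀ + 1) n₁ n₂ (m₃ + 1) G).polymerActivity
          (twistFamily (finTorusStackTwist03 n₁ n₂ z ((finRotate (m₀ + 1))^[k] u) v) w) X =
        (finTorusSystem (m₀ + 1) n₁ n₂ (m₃ + 1) G).polymerActivity (twistFamily (finTorusStackTwist03 n₁ n₂ z u v) w) X := by
    intro k u v
    induction k with
    | zero => rfl
    | succ k ih => rw [Function.iterate_succ_apply', polymerActivity_finTorusStackTwist03_rotate_fst hz, ih]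
  have h1 : ∀ (k : ℕ) (u : Fin (m₀ + 1)) (v : Fin (m₃ + 1)),
      (finTorusSystem (m₀ + 1) n₁ n₂ (m₃ + 1) G).polymerActivity (twistFamily (finTorusStackTwist03 n₁ n₂ z u v) w) X =
        (finTorusSystem (m₀ + 1) n₁ n₂ (m₃ + 1) G).polymerActivity
          (twistFamily (finTorusStackTwist03 n₁ n₂ z u ((finRotate (m₃ + 1))^[k] v)) w) X := by
    intro k u v
    induction k with
    | zero => rfl
    | succ k ih => rw [Function.iterate_succ_apply', ← polymerActivity_finTorusStackTwist03_rotate_snd hz, ih]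
  have key : ∀ (u : Fin (m₀ + 1)) (v : Fin (m₃ + 1)),
      (finTorusSystem (m₀ + 1) n₁ n₂ (m₃ + 1) G).polymerActivity (twistFamily (finTorusStackTwist03 n₁ n₂ z u v) w) X =
        (finTorusSystem (m₀ + 1) n₁ n₂ (m₃ + 1) G).polymerActivity (twistFamily (finTorusStackTwist03 n₁ n₂ z 0 0) w) X := by
    intro u v
    obtain ⟨k₀, hk₀⟩ := exists_iterate_finRotate_zero_eq' u
    obtain ⟨k₁, hk₁⟩ := exists_iterate_finRotate_zero_eq' v
    rw [← hk₀, h0 k₀ 0 v, ← hk₁, ← h1 k₁ 0 0]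
  rw [key a b, key a' b']

/-- **★ The temporal twist is invisible to polymers with fewer than `n₀ · n₃` plaquettes** (central `z`; any box; any family of weights):
the threshold is the AREA `L_s · L_t` of the twisted temporal plane. [cite: Tomboulis2007Confinement, §6.2 eqs. (6.10)–(6.11)] [cite: ItoSeiler2008Further, §2 Thm 2.2 (1)] -/
theorem polymerActivity_finTorusStackTwist03_eq_of_card_lt {z : G} (hz : z ∈ Subgroup.center G) (a : Fin n₀) (b : Fin n₃)
    (w : FinTorusPlaquette n₀ n₁ n₂ n₃ → G → ℝ) {X : Finset (FinTorusPlaquette n₀ n₁ n₂ n₃)} (hX : X.card < n₀ * n₃) :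
    (finTorusSystem n₀ n₁ n₂ n₃ G).polymerActivity (twistFamily (finTorusStackTwist03 n₁ n₂ z a b) w) X =
      (finTorusSystem n₀ n₁ n₂ n₃ G).polymerActivity w X := by
  have hcard : X.card < Fintype.card (Fin n₀ × Fin n₃) := by simpa using hX
  exact (finTorusSystem n₀ n₁ n₂ n₃ G).polymerActivity_twistFamily_eq_of_translates
    (T := fun ab : Fin n₀ × Fin n₃ => finTorusStack03 n₁ n₂ ab.1 ab.2) (fun ab ab' h => disjoint_finTorusStack03 h)
    (t := fun ab : Fin n₀ × Fin n₃ => finTorusStackTwist03 n₁ n₂ z ab.1 ab.2)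
    (fun ab p hp => finTorusStackTwist03_of_not_mem hp) w
    (fun ab ab' Y => polymerActivity_finTorusStackTwist03_eq hz ab.1 ab'.1 ab.2 ab'.2 w Y) (a, b) hcard

end Moves

/-! ### Bridge to 't Hooft's anisotropic twisted partition function of the plane `(0,3)` and the strong-coupling bound -/

section Bridge

variable {G : Type*} [Group G] {N : ℕ} (ρ : G →* Matrix (Fin N) (Fin N) ℂ) [TopologicalSpace G]
  [IsTopologicalGroup G] [CompactSpace G] [MeasurableSpace G] [BorelSpace G] {Ls Lt : ℕ}

omit [TopologicalSpace G] [IsTopologicalGroup G] [CompactSpace G] [MeasurableSpace G] [BorelSpace G] in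
/-- Pointwise form of the Wilson Gibbs factor with insertions (plumbing). [folklore] -/
private theorem exp_neg_mul_sum_eq_pow_mul_prod' (β : ℝ) (s : FinTorusPlaquette Ls Ls Ls Lt → ℝ) :
    Real.exp (-β * ∑ p : FinTorusPlaquette Ls Ls Ls Lt, ((N : ℝ) - s p)) =
      Real.exp (-(β * N)) ^ Fintype.card (FinTorusPlaquette Ls Ls Ls Lt) *
        ∏ p : FinTorusPlaquette Ls Ls Ls Lt, Real.exp (β * s p) := by
  rw [neg_mul, Finset.mul_sum, ← Finset.sum_neg_distrib, Real.exp_sum, ← Finset.card_univ, ← Finset.prod_const,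
    ← Finset.prod_mul_distrib]
  refine Finset.prod_congr rfl fun p _ => ?_
  rw [← Real.exp_add]
  congr 1
  ring

omit [TopologicalSpace G] [IsTopologicalGroup G] [CompactSpace G] [MeasurableSpace G] [BorelSpace G] in
/-- 't Hooft's `(0,3)`-twist factor of `twistedPartitionFunctionAniso_eq_integral` is the stack insertion at `(0, 0)`.
[cite: tHooft1979Flux, §2 (2.5)–(2.6)] -/
theorem tHooft_factor_03_eq_finTorusStackTwist03 [NeZero Ls] [NeZero Lt] (z : G) (x : FinTorusSite Ls Ls Ls Lt)
    (q' : {p : Fin 4 × Fin 4 // p.1 < p.2}) :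
    (if q' = ⟨((0 : Fin 4), (3 : Fin 4)), by decide⟩ ∧ finTorusSiteCoord x (0 : Fin 4) = 0 ∧
        finTorusSiteCoord x (3 : Fin 4) = 0 then z else 1) =
      finTorusStackTwist03 Ls Ls z (0 : Fin Ls) (0 : Fin Lt) (x, q') := by
  rw [finTorusStackTwist03_apply]
  have h0 : finTorusSiteCoord x (0 : Fin 4) = 0 ↔ x.1 = 0 := by
    rw [show finTorusSiteCoord x 0 = (x.1 : ℕ) from rfl, Fin.val_eq_zero_iff]
  have h3 : finTorusSiteCoord x (3 : Fin 4) = 0 ↔ x.2.2.2 = 0 := by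
    rw [show finTorusSiteCoord x 3 = (x.2.2.2 : ℕ) from rfl, Fin.val_eq_zero_iff]
  simp only [h0, h3]

/-- **Bridge.**  't Hooft's `(0,3)`-twisted partition function of `L_s × L_s × L_s × L_t` is `e^{-βN·#plaquettes}` times the partition function
of Wilson's family twisted by the insertion `z·𝟙_{stack03(0,0)}`. [cite: tHooft1979Flux, §2 (2.5)–(2.6)] [cite: Tomboulis2007Confinement, §6.1 eq. (6.1)] -/
theorem twistedPartitionFunctionAniso_03_eq_mul_Z [NeZero Ls] [NeZero Lt] (β : ℝ) (z : G) :
    twistedPartitionFunctionAniso ρ β Ls Lt z ⟨((0 : Fin 4), (3 : Fin 4)), by decide⟩ =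
      Real.exp (-(β * N)) ^ Fintype.card (FinTorusPlaquette Ls Ls Ls Lt) *
        (finTorusSystem Ls Ls Ls Lt G).Z
          (twistFamily (finTorusStackTwist03 Ls Ls z (0 : Fin Ls) (0 : Fin Lt)) fun _ W => Real.exp (β * ((ρ W).trace).re)) := by
  rw [twistedPartitionFunctionAniso_eq_integral, finTorusSystem_Z, ← integral_const_mul]
  refine integral_congr_ae (ae_of_all _ fun U => ?_)
  dsimp only
  rw [← Fintype.sum_prod_type' (f := fun (x : FinTorusSite Ls Ls Ls Lt) (q' : {p : Fin 4 × Fin 4 // p.1 < p.2}) =>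
      ((N : ℝ) - (ρ ((if q' = ⟨((0 : Fin 4), (3 : Fin 4)), by decide⟩ ∧ finTorusSiteCoord x (0 : Fin 4) = 0 ∧
          finTorusSiteCoord x (3 : Fin 4) = 0 then z else 1) * finTorusPlaquette U x q'.1.1 q'.1.2)).trace.re)),
    exp_neg_mul_sum_eq_pow_mul_prod']
  congr 1
  refine Finset.prod_congr rfl fun p _ => ?_
  simp only [twistFamily, tHooft_factor_03_eq_finTorusStackTwist03]

variable [SecondCountableTopology G]

/-- **★★ The strong-coupling bound with rate for the TEMPORAL plane `(0,3)`.**  For second-countable compact `G`, continuous `ρ : G →* M_N(ℂ)`,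
central `z`, `τ ≥ 1`, `N|β| ≤ 1`, `97² e^{1+τ}·2N|β| ≤ 1/2`, every box `L_s³ × L_t` (`L_s, L_t ≥ 1`):
`|ln Z_z(L_s,L_t) - ln Z_1(L_s,L_t)| ≤ 12 · L_s³ L_t · e^{-τ L_s L_t}` — the polymer expansion sees the twist only through polymers with at
least `L_s · L_t` plaquettes. [cite: ItoSeiler2008Further, §2 Thm 2.2 (1)] [cite: Tomboulis2007Confinement, §6.2 eqs. (6.10)–(6.12)] -/
theorem abs_log_twistedPartitionFunctionAniso_03_sub_le_rate [NeZero Ls] [NeZero Lt] (hρ : Continuous ρ) {β τ : ℝ} (hτ : 1 ≤ τ)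
    (hNβ1 : (N : ℝ) * |β| ≤ 1) (hsmall : ((97 : ℝ)) ^ 2 * (Real.exp (1 + τ) * (2 * N * |β|)) ≤ 1 / 2)
    {z : G} (hz : z ∈ Subgroup.center G) :
    |Real.log (twistedPartitionFunctionAniso ρ β Ls Lt z ⟨((0 : Fin 4), (3 : Fin 4)), by decide⟩) -
        Real.log (twistedPartitionFunctionAniso ρ β Ls Lt 1 ⟨((0 : Fin 4), (3 : Fin 4)), by decide⟩)| ≤
      12 * ((Ls : ℝ) ^ 3 * Lt) * Real.exp (-(τ * ((Ls : ℝ) * Lt))) := by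
  set S := finTorusSystem Ls Ls Ls Lt G with hS
  set w : FinTorusPlaquette Ls Ls Ls Lt → G → ℝ := fun _ W => Real.exp (β * ((ρ W).trace).re) with hw
  set t := finTorusStackTwist03 Ls Ls z (0 : Fin Ls) (0 : Fin Lt) with ht
  have hε₁ : ∀ (p : FinTorusPlaquette Ls Ls Ls Lt) (W : G), |twistFamily t w p W - 1| ≤ 2 * N * |β| := fun p W =>
    CentralTwist.abs_exp_mul_re_trace_sub_one_le ρ hρ hNβ1 _
  have hε₂ : ∀ (p : FinTorusPlaquette Ls Ls Ls Lt) (W : G), |w p W - 1| ≤ 2 * N * |β| := fun p W =>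
    CentralTwist.abs_exp_mul_re_trace_sub_one_le ρ hρ hNβ1 _
  have hsmall' : (((96 : ℕ) : ℝ) + 1) ^ 2 * (Real.exp (1 + τ) * (2 * N * |β|)) ≤ 1 / 2 := by
    norm_num at hsmall ⊢; exact hsmall
  have hsmall1 : (((96 : ℕ) : ℝ) + 1) ^ 2 * (Real.exp 2 * (2 * N * |β|)) ≤ 1 / 2 :=
    PlaquetteSystem.kpSmall_of_rate (Δ := 96) (by positivity) hτ hsmall'
  have hw₁ : ∀ p, Measurable (twistFamily t w p) := fun p =>
    (CentralTwist.measurable_exp_mul_re_trace ρ hρ β).comp (measurable_const_mul (t p))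
  have hw₂ : ∀ p, Measurable (w p) := fun p => CentralTwist.measurable_exp_mul_re_trace ρ hρ β
  have hhol : ∀ p, Measurable fun U : FinTorusLink Ls Ls Ls Lt → G => S.hol U p := measurable_finTorusSystem_hol
  have hΔ : ∀ p, (S.nbrs p).card ≤ 96 := card_nbrs_finTorusSystem_le
  have hagree : ∀ X : Finset (FinTorusPlaquette Ls Ls Ls Lt), X.card < Ls * Lt →
      S.polymerActivity (twistFamily t w) X = S.polymerActivity w X := fun X hX =>
    polymerActivity_finTorusStackTwist03_eq_of_card_lt hz 0 0 w hX
  have hmain := S.abs_log_Z_sub_log_Z_le_of_agree_rate hhol hΔ hw₁ hw₂ hε₁ hε₂ hτ hsmall' hagree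
  have hZ₁ : 0 < S.Z (twistFamily t w) := S.Z_pos_of_kpSmall hhol hw₁ hε₁ hsmall1
  have hZ₂ : 0 < S.Z w := S.Z_pos_of_kpSmall hhol hw₂ hε₂ hsmall1
  have hc : 0 < Real.exp (-(β * N)) ^ Fintype.card (FinTorusPlaquette Ls Ls Ls Lt) := pow_pos (Real.exp_pos _) _
  have h1 : twistedPartitionFunctionAniso ρ β Ls Lt z ⟨((0 : Fin 4), (3 : Fin 4)), by decide⟩ =
      Real.exp (-(β * N)) ^ Fintype.card (FinTorusPlaquette Ls Ls Ls Lt) * S.Z (twistFamily t w) :=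
    twistedPartitionFunctionAniso_03_eq_mul_Z ρ β z
  have h2 : twistedPartitionFunctionAniso ρ β Ls Lt 1 ⟨((0 : Fin 4), (3 : Fin 4)), by decide⟩ =
      Real.exp (-(β * N)) ^ Fintype.card (FinTorusPlaquette Ls Ls Ls Lt) * S.Z w := by
    rw [twistedPartitionFunctionAniso_03_eq_mul_Z ρ β (1 : G), finTorusStackTwist03_one, twistFamily_one]
  rw [h1, h2, Real.log_mul hc.ne' hZ₁.ne', Real.log_mul hc.ne' hZ₂.ne', add_sub_add_left_eq_sub]
  refine hmain.trans (le_of_eq ?_)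
  rw [card_finTorusPlaquette]
  push_cast
  ring

/-- **★★ The temporal-plane ceiling with the explicit rate.**  For `0 < N|β| ≤ 1/(4·97²e²)`, central `z`, every box `L_s³ × L_t`:
`|ln Z_z(L_s,L_t) - ln Z_1(L_s,L_t)| ≤ 12 · L_s³ L_t · (4·97²e·N|β|)^{L_s L_t}` for the twist of the temporal plane `(0,3)` — exponentially small in
the AREA `L_s L_t`. [cite: ItoSeiler2008Further, §2 Thm 2.2 (1)] [cite: Tomboulis2007Confinement, §6.2 eq. (6.12)] -/
theorem abs_log_twistedPartitionFunctionAniso_03_sub_le_pow [NeZero Ls] [NeZero Lt] (hρ : Continuous ρ) {β : ℝ}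
    (hβ0 : 0 < (N : ℝ) * |β|) (hβ : (N : ℝ) * |β| ≤ 1 / (4 * ((97 : ℝ) ^ 2 * Real.exp 2))) {z : G} (hz : z ∈ Subgroup.center G) :
    |Real.log (twistedPartitionFunctionAniso ρ β Ls Lt z ⟨((0 : Fin 4), (3 : Fin 4)), by decide⟩) -
        Real.log (twistedPartitionFunctionAniso ρ β Ls Lt 1 ⟨((0 : Fin 4), (3 : Fin 4)), by decide⟩)| ≤
      12 * ((Ls : ℝ) ^ 3 * Lt) * (4 * (97 : ℝ) ^ 2 * Real.exp 1 * (N * |β|)) ^ (Ls * Lt) := by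
  set κ : ℝ := 4 * (97 : ℝ) ^ 2 * Real.exp 1 * (N * |β|) with hκ
  have hκ0 : 0 < κ := by positivity
  have he1 : (1 : ℝ) ≤ Real.exp 1 := Real.one_le_exp (by norm_num)
  have hκe : κ * Real.exp 1 ≤ 1 := by
    have h := hβ
    rw [le_div_iff₀ (by positivity)] at h
    have : Real.exp 1 * Real.exp 1 = Real.exp 2 := by rw [← Real.exp_add]; norm_num
    nlinarith [Real.exp_pos 1, Real.exp_pos 2]
  have hκ1 : κ ≤ 1 := by nlinarith
  set τ : ℝ := -Real.log κ with hτdef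
  have hexpτ : Real.exp (-τ) = κ := by rw [hτdef, neg_neg, Real.exp_log hκ0]
  have hexpτ' : Real.exp τ = κ⁻¹ := by
    have h := hexpτ
    rw [Real.exp_neg] at h
    rw [← h, inv_inv]
  have hτ1 : 1 ≤ τ := by
    have hk : κ ≤ Real.exp (-1) := by
      rw [Real.exp_neg, ← one_div]
      exact (le_div_iff₀ (Real.exp_pos 1)).2 hκe
    have hlog : Real.log κ ≤ -1 := (Real.log_le_iff_le_exp hκ0).2 hk
    rw [hτdef]
    linarith
  have hNβ1 : (N : ℝ) * |β| ≤ 1 := by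
    have : 1 / (4 * ((97 : ℝ) ^ 2 * Real.exp 2)) ≤ 1 := by
      rw [div_le_iff₀ (by positivity)]
      nlinarith [Real.one_le_exp (show (0:ℝ) ≤ 2 by norm_num)]
    linarith
  have hsmall : ((97 : ℝ)) ^ 2 * (Real.exp (1 + τ) * (2 * N * |β|)) ≤ 1 / 2 := by
    have hexp : Real.exp (1 + τ) = Real.exp 1 * κ⁻¹ := by rw [Real.exp_add, hexpτ']
    have hx : (N : ℝ) * |β| ≠ 0 := hβ0.ne'
    have hN : (N : ℝ) ≠ 0 := (mul_ne_zero_iff.1 hx).1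
    have hb : |β| ≠ 0 := (mul_ne_zero_iff.1 hx).2
    have hval : ((97 : ℝ)) ^ 2 * (Real.exp 1 * κ⁻¹ * (2 * N * |β|)) = 1 / 2 := by
      rw [hκ]
      have he : Real.exp 1 ≠ 0 := (Real.exp_pos 1).ne'
      field_simp
      ring
    rw [hexp, hval]
  have h := abs_log_twistedPartitionFunctionAniso_03_sub_le_rate (Ls := Ls) (Lt := Lt) ρ hρ hτ1 hNβ1 hsmall hz
  refine h.trans (le_of_eq ?_)
  congr 1
  rw [← hexpτ, ← Real.exp_nat_mul]
  congr 1
  push_cast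
  ring

end Bridge

end Literature.MathematicalPhysics.QuantumFieldTheory

end
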